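import Summits.CriticalPhenomena.PercolationContinuityZ3.Theorems.PercNearOneGluingNoHeavyLowerTailSahiTangentPatternTwoKernel

/-!
# `NoHeavyLowerTail` (crux stmt-CriticalPhenomena-4575), Sahi programme: the tangent pattern inequality in dimension two,
# part 2 — THE FINITE CHECK and **`TangentPatternPos 2`**

Support file (Sahi cell, seat `prim-sahi-p1`, generation 48; `--supports stmt-CriticalPhenomena-4575`).  COMPUTATIONAL: exactly ONE
`native_decide` evaluation (`checkTPP2_eq_true`, `Lean.ofReduceBool`) of a Boolean check whose MEANING is proved here in the kernel with
standard axioms; no `sorry`.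

WHAT IS CERTIFIED.  With the vocabulary of part 1 (`…SahiTangentPatternTwoKernel`: the trilinear expansion
`sStarT T B = Σ_{u∈S₀} Σ_{v∈S₁} Σ_{w∈S₂} sT1 u v w` over the pair-sets `S_i = pairSet (T i) (B i) ⊆ Bool × [3]²`, the coefficient
tensor on indices `CI`, and the `175` pairs `B ⊆ T` of up-sets of `[3]²` as pairs of threshold vectors `pairVecs`): for ALL ordered triples
`(i, j, k)` of pairs, `Σ_{u ∈ S_i} Σ_{v ∈ S_j} Σ_{w ∈ S_k} C(u,v,w) ≥ 0` — `175³ = 5 359 375` values, organised as `V_i(v,w) = Σ_{u∈S_i} C`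
(`Varr`), `W_{ij}(w) = Σ_{v∈S_j} V_i` (`Warr`), `Σ_{w∈S_k} W_{ij}` (`finS`); every table access is specified in the kernel (`Ctab_get`,
`Varr_get`, `Warr_get`, `finS_eq`, `agetL_membArr`), so only the evaluation `checkTPP2 = true` is trusted to the compiler.  Hence
* **`tangentPatternPos_two : TangentPatternPos 2`** — the tangent pattern inequality on `[3]²`;
and, by the all-`d` reductions of `…SahiTangentPattern` (corollaries in part 3, `…SahiTangentPatternTwoGrid`), Conjecture T₃ of memo
FROM-prim-sahi-p2-gen32-TANGENT for every product weight on every two-dimensional grid × coin.  Outside Lean the same numbers (min `0`,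
`159 439` zeros, max `36`) were obtained by two independent programs (prim-sahi-p1 gen 47 `tpp2.py` / kit j306089 on unordered triples:
`908 600`, `0` negative; gen 48 `code/tpp2_tensor.py`, this tensor method, pure integers).  HONEST LABEL: computational (one `native_decide`).
[this work] [computational]
-/

namespace Summit.CriticalPhenomena.PercolationContinuityZ3.Theorems.SahiTangent

open Finset Literature.Probability.LatticeModels Literature.Combinatorics.Sahi2008
open SahiGrid3 (ind agetZ foldl_add_eq' sum_map_filter sum_map_range)
open SahiGridPattern (Pd col)
open scoped BigOperators

/-! ### The `175` pairs and their member-index lists -/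

/-- The pairs `(v, w)` of monotone threshold vectors with `w ≤ v` pointwise (`U2 w ⊆ U2 v`): the `175` pairs `B ⊆ T` of up-sets of `[3]²`,
`v` the top, `w` the bottom. [this work] -/
def pairVecs : List (List ℕ × List ℕ) := (upVecs2.product upVecs2).filter fun p => leV p.2 p.1

/-- There are `175` pairs (kernel `decide`). [this work] -/
theorem length_pairVecs : pairVecs.length = 175 := by decide +kernel

/-- **The pair of threshold vectors of a pair of up-sets `B ⊆ T` is in the list.** [this work] -/
theorem mem_pairVecs {T B : Finset P2} (hT : IsUpperSet (T : Set P2)) (hB : IsUpperSet (B : Set P2)) (hBT : B ⊆ T) :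
    (vecOf2 T, vecOf2 B) ∈ pairVecs := by
  unfold pairVecs
  rw [List.mem_filter, List.pair_mem_product]
  exact ⟨⟨vecOf2_mem_upVecs2 hT, vecOf2_mem_upVecs2 hB⟩, leV_vecOf2 hBT⟩

/-- Membership of the point with index `n < 9` in the staircase `U2 v`, on indices. [this work] -/
def inU (v : List ℕ) (n : ℕ) : Bool := decide (3 - v.getD (n / 3) 0 ≤ n % 3)

/-- Membership of the point with index `n < 18` of the pair carrier in `pairSet (U2 v) (U2 w)`, on indices. [this work] -/
def inPair (v w : List ℕ) (n : ℕ) : Bool := if n < 9 then inU v n else inU w (n - 9)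

/-- `inU` is membership in `U2`. [this work] -/
theorem inU_pidx (v : List ℕ) (q : P2) : inU v (pidx q) = decide (q ∈ U2 v) := by
  have h0 := (q 0).isLt; have h1 := (q 1).isLt
  have e1 : pidx q / 3 = (q 0 : ℕ) := by unfold pidx; omega
  have e2 : pidx q % 3 = (q 1 : ℕ) := by unfold pidx; omega
  unfold inU U2 thr2
  rw [e1, e2]
  simp only [mem_filter, mem_univ, true_and]

/-- `inPair` is membership in the pair-set. [this work] -/
theorem inPair_widx (v w : List ℕ) (u : W2) : inPair v w (widx u) = decide (u ∈ pairSet (U2 v) (U2 w)) := by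
  obtain ⟨ε, q⟩ := u
  have hq := pidx_lt q
  rw [widx_mk]
  unfold inPair pairSet
  cases ε
  · simp only [Bool.false_eq_true, if_false, show ¬ (pidx q + 9 < 9) from by omega, Nat.add_sub_cancel, inU_pidx,
      mem_filter, mem_univ, true_and]
  · simp only [if_true, hq, inU_pidx, mem_filter, mem_univ, true_and]

/-- The member indices of the pair-set of a pair of threshold vectors. [this work] -/
def membOf (p : List ℕ × List ℕ) : List ℕ := (List.range 18).filter (inPair p.1 p.2)

/-- Sums over member indices are finset sums over the pair-set. [this work] -/
theorem sum_membOf (p : List ℕ × List ℕ) (g : ℕ → ℤ) :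
    ((membOf p).map g).sum = ∑ u ∈ pairSet (U2 p.1) (U2 p.2), g (widx u) := by
  unfold membOf
  rw [sum_map_filter, sum_map_range, sum_range18_eq_sum_univ, ← Finset.sum_filter]
  refine Finset.sum_congr ?_ fun _ _ => rfl
  ext u
  rw [Finset.mem_filter, inPair_widx p.1 p.2 u]
  simp

/-- `foldl (· + g ·)` over member indices is the finset sum over the pair-set. [this work] -/
theorem foldl_membOf (p : List ℕ × List ℕ) (g : ℕ → ℤ) :
    (membOf p).foldl (fun s n => s + g n) 0 = ∑ u ∈ pairSet (U2 p.1) (U2 p.2), g (widx u) := by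
  rw [foldl_add_eq', zero_add, sum_membOf]

/-- The member-index lists of the `175` pairs, as an array. [this work] -/
def membArr : Array (List ℕ) := (pairVecs.map membOf).toArray

/-- Total array access (default `[]`). [this work] -/
def agetL (T : Array (List ℕ)) (i : ℕ) : List ℕ := if h : i < T.size then T[i] else []

/-- `membArr[i] = membOf pairVecs[i]`. [this work] -/
theorem agetL_membArr {i : ℕ} (hi : i < pairVecs.length) : agetL membArr i = membOf (pairVecs[i]) := by
  have hsz : membArr.size = pairVecs.length := by unfold membArr; rw [List.size_toArray, List.length_map]
  unfold agetL
  rw [dif_pos (by rw [hsz]; exact hi)]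
  unfold membArr
  rw [List.getElem_toArray, List.getElem_map]

/-! ### The coefficient table and the partial sums `V`, `W` -/

/-- The table of the `18³` coefficients `CI a b c` at index `324a + 18b + c`. [this work] -/
def Ctab : Array ℤ := Array.ofFn fun n : Fin 5832 => CI ((n : ℕ) / 324) ((n : ℕ) / 18 % 18) ((n : ℕ) % 18)

/-- Table lookup is `CI`. [this work] -/
theorem Ctab_get {a b c : ℕ} (ha : a < 18) (hb : b < 18) (hc : c < 18) : agetZ Ctab (a * 324 + b * 18 + c) = CI a b c := by
  have hsz : Ctab.size = 5832 := by unfold Ctab; rw [Array.size_ofFn]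
  have hi : a * 324 + b * 18 + c < Ctab.size := by rw [hsz]; omega
  unfold agetZ
  rw [dif_pos hi]
  unfold Ctab
  rw [Array.getElem_ofFn]
  have e1 : (a * 324 + b * 18 + c) / 324 = a := by omega
  have e2 : (a * 324 + b * 18 + c) / 18 % 18 = b := by omega
  have e3 : (a * 324 + b * 18 + c) % 18 = c := by omega
  simp only [e1, e2, e3]

/-- `V_S(b,c) = Σ_{a ∈ S} C(a,b,c)` as a `324`-array (index `18b + c`), from the member list of `S`. [this work] -/
def Varr (C : Array ℤ) (mA : List ℕ) : Array ℤ :=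
  Array.ofFn fun e : Fin 324 => mA.foldl (fun s a => s + agetZ C (a * 324 + e)) 0

/-- `W_{SS'}(c) = Σ_{b ∈ S'} V_S(b,c)` as an `18`-array, from the member list of `S'`. [this work] -/
def Warr (V : Array ℤ) (mB : List ℕ) : Array ℤ :=
  Array.ofFn fun c : Fin 18 => mB.foldl (fun s b => s + agetZ V (b * 18 + c)) 0

/-- The final sum `Σ_{c ∈ S''} W(c)` from the member list of `S''`. [this work] -/
def finS (W : Array ℤ) (mC : List ℕ) : ℤ := mC.foldl (fun s c => s + agetZ W c) 0

/-- `Varr` computes `Σ_{u ∈ S} CI (widx u) b c`. [this work] -/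
theorem Varr_get (p : List ℕ × List ℕ) {b c : ℕ} (hb : b < 18) (hc : c < 18) :
    agetZ (Varr Ctab (membOf p)) (b * 18 + c) = ∑ u ∈ pairSet (U2 p.1) (U2 p.2), CI (widx u) b c := by
  have hsz : (Varr Ctab (membOf p)).size = 324 := by unfold Varr; rw [Array.size_ofFn]
  have hi : b * 18 + c < (Varr Ctab (membOf p)).size := by rw [hsz]; omega
  unfold agetZ
  rw [dif_pos hi]
  unfold Varr
  rw [Array.getElem_ofFn, foldl_membOf]
  refine Finset.sum_congr rfl fun u _ => ?_
  show agetZ Ctab (widx u * 324 + (b * 18 + c)) = _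
  rw [← Nat.add_assoc]
  exact Ctab_get (widx_lt u) hb hc

/-- `Warr ∘ Varr` computes `Σ_{v ∈ S'} Σ_{u ∈ S} CI (widx u) (widx v) c`. [this work] -/
theorem Warr_get (p p' : List ℕ × List ℕ) {c : ℕ} (hc : c < 18) :
    agetZ (Warr (Varr Ctab (membOf p)) (membOf p')) c =
      ∑ v ∈ pairSet (U2 p'.1) (U2 p'.2), ∑ u ∈ pairSet (U2 p.1) (U2 p.2), CI (widx u) (widx v) c := by
  have hsz : (Warr (Varr Ctab (membOf p)) (membOf p')).size = 18 := by unfold Warr; rw [Array.size_ofFn]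
  have hi : c < (Warr (Varr Ctab (membOf p)) (membOf p')).size := by rw [hsz]; exact hc
  unfold agetZ
  rw [dif_pos hi]
  unfold Warr
  rw [Array.getElem_ofFn, foldl_membOf]
  refine Finset.sum_congr rfl fun v (_ : v ∈ pairSet (U2 p'.1) (U2 p'.2)) => ?_
  exact Varr_get p (widx_lt v) hc

/-- `finS ∘ Warr ∘ Varr` computes the full trilinear sum, i.e. `sStarT`. [this work] -/
theorem finS_eq (p p' p'' : List ℕ × List ℕ) :
    finS (Warr (Varr Ctab (membOf p)) (membOf p')) (membOf p'') =
      ∑ u ∈ pairSet (U2 p.1) (U2 p.2), ∑ v ∈ pairSet (U2 p'.1) (U2 p'.2), ∑ w ∈ pairSet (U2 p''.1) (U2 p''.2), sT1 u v w := by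
  unfold finS
  rw [foldl_membOf, Finset.sum_congr rfl fun w (_ : w ∈ pairSet (U2 p''.1) (U2 p''.2)) => Warr_get p p' (widx_lt w)]
  simp_rw [CI_widx]
  rw [Finset.sum_comm (s := pairSet (U2 p''.1) (U2 p''.2)) (t := pairSet (U2 p'.1) (U2 p'.2))]
  have h1 : ∀ v : W2, ∑ w ∈ pairSet (U2 p''.1) (U2 p''.2), ∑ u ∈ pairSet (U2 p.1) (U2 p.2), sT1 u v w =
      ∑ u ∈ pairSet (U2 p.1) (U2 p.2), ∑ w ∈ pairSet (U2 p''.1) (U2 p''.2), sT1 u v w := fun v => Finset.sum_comm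
  rw [Finset.sum_congr rfl fun v (_ : v ∈ pairSet (U2 p'.1) (U2 p'.2)) => h1 v]
  exact Finset.sum_comm

/-! ### The check, its single `native_decide` evaluation, and its soundness -/

/-- **The check**: for all ordered triples `(i, j, k)` of the `175` pairs, `Σ_{u∈S_i} Σ_{v∈S_j} Σ_{w∈S_k} C(u,v,w) ≥ 0`
(tables passed once; `V_i` reused over `j, k`, `W_{ij}` over `k`). [this work] -/
def checkTPP2 : Bool :=
  let M := membArr
  let C := Ctab
  (List.range 175).all fun i =>
    let V := Varr C (agetL M i)
    (List.range 175).all fun j =>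
      let W := Warr V (agetL M j)
      (List.range 175).all fun k => decide (0 ≤ finS W (agetL M k))

/-- THE CERTIFICATE: the check passes (COMPUTATIONAL, `native_decide`; `5 359 375` trilinear sums, a few seconds natively). [this work]
[computational] -/
theorem checkTPP2_eq_true : checkTPP2 = true := by native_decide

/-- **Soundness of the check**: a passing check gives the trilinear sum `≥ 0` for every three listed pairs. [this work] -/
theorem nonneg_of_checkTPP2 (h : checkTPP2 = true) {v₀ w₀ v₁ w₁ v₂ w₂ : List ℕ} (h₀ : (v₀, w₀) ∈ pairVecs)
    (h₁ : (v₁, w₁) ∈ pairVecs) (h₂ : (v₂, w₂) ∈ pairVecs) :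
    0 ≤ ∑ u ∈ pairSet (U2 v₀) (U2 w₀), ∑ v ∈ pairSet (U2 v₁) (U2 w₁), ∑ w ∈ pairSet (U2 v₂) (U2 w₂), sT1 u v w := by
  obtain ⟨i, hi, ei⟩ := List.getElem_of_mem h₀
  obtain ⟨j, hj, ej⟩ := List.getElem_of_mem h₁
  obtain ⟨k, hk, ek⟩ := List.getElem_of_mem h₂
  have hi' : i < 175 := by rw [← length_pairVecs]; exact hi
  have hj' : j < 175 := by rw [← length_pairVecs]; exact hj
  have hk' : k < 175 := by rw [← length_pairVecs]; exact hk
  unfold checkTPP2 at h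
  simp only [List.all_eq_true, List.mem_range, decide_eq_true_eq] at h
  have h1 := h i hi' j hj' k hk'
  rw [agetL_membArr hi, agetL_membArr hj, agetL_membArr hk, finS_eq, ei, ej, ek] at h1
  exact h1

/-- **`TangentPatternPos 2`** — THE TANGENT PATTERN INEQUALITY ON `[3]²`: `sStarT T B ≥ 0` for all triples of pairs `B_i ⊆ T_i` of
up-sets of the square (the polarised kernel of the order-3 tangent functional `T₃` is nonnegative under Latin-square sampling of `[3]²`).
COMPUTATIONAL (rests on `checkTPP2_eq_true`). [this work] [computational] -/
theorem tangentPatternPos_two : TangentPatternPos 2 := by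
  intro T B hT hB hBT
  have e : ∀ s : Fin 3, pairSet (T s) (B s) = pairSet (U2 (vecOf2 (T s))) (U2 (vecOf2 (B s))) := fun s => by
    rw [U2_vecOf2 (hT s), U2_vecOf2 (hB s)]
  rw [sStarT_eq_sum_single, e 0, e 1, e 2]
  exact nonneg_of_checkTPP2 checkTPP2_eq_true (mem_pairVecs (hT 0) (hB 0) (hBT 0)) (mem_pairVecs (hT 1) (hB 1) (hBT 1))
    (mem_pairVecs (hT 2) (hB 2) (hBT 2))

end Summit.CriticalPhenomena.PercolationContinuityZ3.Theorems.SahiTangent
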